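import Summits.CriticalPhenomena.PercolationContinuityZ3.Theorems.PercNearOneGluingNoHeavyQuantTwinMove
import Summits.CriticalPhenomena.PercolationContinuityZ3.Theorems.PercNearOneGluingNoHeavyQuantFlowTransfer
import Summits.CriticalPhenomena.PercolationContinuityZ3.Theorems.PercNearOneGluingNoHeavyQuantIncomeDichotomy
import HarnessLib

/-!
# QUANT lane R8, T-DEC, leg (III): THE TWIN MOVE LEMMA, CASE (A) WHEN THE BLOB ATOM IS A MID OF `P` (`t ≤ 2a`, the regime R2 of TWIN-MOVE-G39 §12) —
# a flow of `Λ` with no nonzero low of `P` on the giants whose transfer does not overload the column `a` ⟹ `P` DEC (`twinMove_of_midFlowMid`)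

builds on p205010 (kernel theorem, internal audit signed; external expert review pending)

Support file (`--supports stmt-CriticalPhenomena-4575`), QUANT lane seat prim-quant-arm-1 (gen 39), rung R8 of
`run/shared/lean/prim/quant/LADDER.md`.  Theorems only (no definitions), standard axioms, no sorries.  Companion of `twinMove_of_midFlow`
(`…QuantTwinMoveCaseA`, the regime `2a < t`).  In the regime `t ≤ 2a` the blob atom `a ≤ j` is a MID of `P` whose capacity is SMALLER than in `Λ` by
`zg`; the transfer (`transfer_partialRouting`) of a flow witness `f` of `Λ` at `τ` routes every nonzero low of `P` into mids at the lower rates, and if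
(i) `f` keeps every nonzero `t`-low of `P` off the giants and (ii) the transferred load at `a` still fits (`Σ_l usage_t(l,a)·f l a ≤ P a`), then every
nonzero low sits in a mid within capacity and `flowAtT_of_midRouting` (case (A) of the income dichotomy) gives DEC.  Exact census (TWIN-MOVE-G39 §12,
probes 30–31): in the regime `2a ≥ τ` a giant-minimal flow of `Λ` satisfies (i) in 92 % of the boundary-pushed instances and then (ii) in 89 % — the
remaining instances need the twin re-routing of the excess at `a` (open).

* **`LawDec.twinMove_of_midFlowMid`** — TwinMove data, `t ≤ 2a`, `a ≤ j`, a flow witness `f` of `Λ` at `(y, τ, j, N)` with `f l h = 0` whenever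
  `l ≥ 1`, `2l < t`, `j+1 ≤ h`, and `Σ_{l ≤ j, 1 ≤ l, 2l < t} usage_t(l,a)·f l a ≤ P a` ⟹ `DECAtT y t j N P`.

[this work]; nothing here is cited as a published result.  The gluing rows served [cite: KozmaNitzan2024, Conjecture 3 (p. 15)]; product measure
[cite: Grimmett1999, §1.3 p. 10].
-/

noncomputable section

namespace Summit.CriticalPhenomena.PercolationContinuityZ3.Theorems

namespace Quant

open Finset

/-- the two-point law `{lo, hi; g}` (as in `…QuantLawDEC`) -/
local notation3 "TP[" lo ", " hi ", " g ", " h "]" =>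
  (g : ℝ) * (if (h : ℕ) = (hi : ℕ) then (1 : ℝ) else 0) + (1 - (g : ℝ)) * (if (h : ℕ) = (lo : ℕ) then (1 : ℝ) else 0)

namespace LawDec

/-- **TWIN MOVE, CASE (A), THE BLOB ATOM A MID OF `P`.**  See the module docstring. [this work] -/
theorem twinMove_of_midFlowMid (y z g : ℝ) (a j N : ℕ) (R : ℕ → ℝ) (f : ℕ → ℕ → ℝ)
    (hy0 : 0 < y) (hy1 : y < 1) (hz0 : 0 ≤ z) (hz1 : z < 1) (hg0 : 0 ≤ g)
    (hR0 : ∀ h, 0 ≤ R h) (hRN : ∀ h, N < h → R h = 0) (hR1 : ∑ h ∈ Finset.range (N + 1), R h = 1)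
    (hta : y * (N : ℝ) ≤ (1 - z) * ∑ h ∈ Finset.range (N + 1), (h : ℝ) * R h)
    (ht0 : 0 < (1 - z) * ∑ h ∈ Finset.range (N + 1), (h : ℝ) * R h)
    (hta2 : (1 - z) * ∑ h ∈ Finset.range (N + 1), (h : ℝ) * R h ≤ 2 * (a : ℝ)) (haj : a ≤ j)
    (hf : IsFlowAtT y (z * (a : ℝ) * g + (1 - z) * ∑ h ∈ Finset.range (N + 1), (h : ℝ) * R h) j N
      (fun h => z * TP[0, a, g, h] + (1 - z) * R h) f)
    (hnog : ∀ l h : ℕ, 1 ≤ l → 2 * (l : ℝ) < (1 - z) * ∑ h ∈ Finset.range (N + 1), (h : ℝ) * R h → j + 1 ≤ h → f l h = 0)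
    (hnoover : ∑ l ∈ Finset.range (j + 1),
        (if (1 ≤ l ∧ 2 * (l : ℝ) < (1 - z) * ∑ h ∈ Finset.range (N + 1), (h : ℝ) * R h) then
          usage y ((1 - z) * ∑ h ∈ Finset.range (N + 1), (h : ℝ) * R h) j l a * f l a else 0)
      ≤ (1 - z) * R a) :
    DECAtT y ((1 - z) * ∑ h ∈ Finset.range (N + 1), (h : ℝ) * R h) j N
      (fun h => z * (if h = 0 then (1 : ℝ) else 0) + (1 - z) * R h) := by
  classical
  set S : ℝ := ∑ h ∈ Finset.range (N + 1), (h : ℝ) * R h with hS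
  set t : ℝ := (1 - z) * S with ht
  set τ : ℝ := z * (a : ℝ) * g + (1 - z) * S with hτ
  set Λ : ℕ → ℝ := fun h => z * TP[0, a, g, h] + (1 - z) * R h with hΛ
  set P : ℕ → ℝ := fun h => z * (if h = 0 then (1 : ℝ) else 0) + (1 - z) * R h with hP
  have h1z : 0 < 1 - z := by linarith
  have ha0 : (0 : ℝ) ≤ a := Nat.cast_nonneg a
  have hzag : 0 ≤ z * (a : ℝ) * g := mul_nonneg (mul_nonneg hz0 ha0) hg0
  have htτ : t ≤ τ := by rw [ht, hτ]; linarith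
  -- facts about `P`
  have hP0 : ∀ h, 0 ≤ P h := fun h => by simp only [hP]; split_ifs <;> nlinarith [hR0 h]
  have hPN : ∀ h, N < h → P h = 0 := fun h hh => by simp only [hP]; rw [hRN h hh, if_neg (by omega)]; ring
  have hP1 : ∑ h ∈ Finset.range (N + 1), P h = 1 := by
    simp only [hP]
    rw [Finset.sum_add_distrib, ← Finset.mul_sum, ← Finset.mul_sum, hR1, Finset.sum_ite_eq' (Finset.range (N + 1)) 0,
      if_pos (Finset.mem_range.2 (Nat.succ_pos N))]
    ring
  have hPmean : ∑ h ∈ Finset.range (N + 1), (h : ℝ) * P h = t := by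
    simp only [hP]
    have e : ∀ h : ℕ, (h : ℝ) * (z * (if h = 0 then (1 : ℝ) else 0) + (1 - z) * R h)
        = (if h = 0 then (h : ℝ) * z else 0) + (1 - z) * ((h : ℝ) * R h) := fun h => by split_ifs <;> ring
    simp_rw [e]
    rw [Finset.sum_add_distrib, ← Finset.mul_sum, Finset.sum_ite_eq' (Finset.range (N + 1)) 0, if_pos (Finset.mem_range.2 (Nat.succ_pos N))]
    simp [ht, hS]
  -- rows shrink: `P l ≤ Λ l` on nonzero lows (equality except at `a`, where `Λ a = P a + zg`), and `P l ≥ 0`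
  have hrows : ∀ l : ℕ, 1 ≤ l → l ≤ j → 2 * (l : ℝ) < t → 0 ≤ P l ∧ P l ≤ Λ l := by
    intro l h1 _ _
    refine ⟨hP0 l, ?_⟩
    have hl0 : l ≠ 0 := by omega
    simp only [hP, hΛ, if_neg hl0]
    by_cases hla : l = a
    · rw [if_pos hla]; nlinarith [mul_nonneg hz0 hg0]
    · rw [if_neg hla]; nlinarith
  -- the transferred routing
  obtain ⟨hφ0, hφsupp, hφrow, hφcol⟩ := transfer_partialRouting y t τ j N Λ P f hy0 hy1 htτ hf hrows
  set φ : ℕ → ℕ → ℝ := fun l h => if (1 ≤ l ∧ 2 * (l : ℝ) < t) then P l / Λ l * f l h else 0 with hφ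
  -- it charges no giant
  have hφgiant : ∀ l h, j + 1 ≤ h → φ l h = 0 := by
    intro l h hh
    simp only [hφ]
    split_ifs with hc
    · rw [hnog l h hc.1 hc.2 hh, mul_zero]
    · rfl
  -- TA for `P` and mid charges
  have htaN : y * (N : ℝ) ≤ t := by rw [ht]; exact hta
  refine decAtT_of_flowAtT y t j N P hy0 hy1 hPN hP1
    (flowAtT_of_midRouting y t j N P φ hy0 hy1 ht0 hP0 hPN htaN hφ0 (fun l h hp => ?_) hφrow (fun h hhj hhM hmid => ?_)
      (by rw [hPmean, hP1, mul_one]))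
  · obtain ⟨hl, hhM, hc⟩ := hφsupp l h hp
    have hng : ¬ (j + 1 ≤ h) := fun hh => by rw [hφgiant l h hh] at hp; exact lt_irrefl _ hp
    have hc' : t < (l : ℝ) + h := hc.resolve_left hng
    refine ⟨hl, by omega, hhM, ?_, hc'⟩
    -- `h` is a mid of `P` at `t`: `t ≤ 2h` since `t < l + h` and `l < t/2 < h`… precisely `2l < t < l + h ⇒ h > t/2`
    linarith [hl.2.2]
  · -- columns: loads at `t` ≤ loads of `f` at `τ` ≤ `Λ h = P h` (`h` a mid of `P`, `h ≠` … `Λ h ≥`?) — at a mid `h` with `t ≤ 2h`, `Λ h = P h`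
    -- unless `h = a`; but `2a < t ≤ 2h` excludes `h = a`; and `h = 0` is excluded by `t ≤ 2h`, `t > 0`.
    have hh0 : h ≠ 0 := by
      intro he; rw [he] at hmid; simp at hmid; linarith
    by_cases hha : h = a
    · -- the blob atom: the transferred load is the hypothesis `hnoover` (all row scales are `1` or the guard fails)
      subst hha
      have hPa : P h = (1 - z) * R h := by simp only [hP, if_neg hh0]; ring
      rw [hPa]
      refine le_trans (Finset.sum_le_sum fun l hl => ?_) hnoover
      simp only [hφ]
      split_ifs with hc
      · have hl0 : l ≠ 0 := by omega
        have hlj : l ≤ j := by have := Finset.mem_range.1 hl; omega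
        obtain ⟨_, hPlΛ⟩ := hrows l hc.1 hlj hc.2
        have hΛPl : Λ l = P l := by
          have hla : l ≠ h := by intro he; rw [he] at hc; linarith [hc.2]
          simp only [hΛ, hP, if_neg hla, if_neg hl0]; ring
        rw [hΛPl]
        rcases (hP0 l).eq_or_lt with hz | hp
        · -- `P l = 0`: the row of `l` in `f` is `Λ l = P l = 0`, so `f l h = 0`
          have : f l h = 0 := by
            obtain ⟨hf0', _, hfrow', _⟩ := hf
            have hr := hfrow' l hlj (by linarith [hc.2])
            rw [hΛPl, ← hz] at hr
            have hle : f l h ≤ ∑ h' ∈ Finset.range (N + 1), f l h' :=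
              Finset.single_le_sum (fun h' _ => hf0' l h') (Finset.mem_range.2 (by omega))
            linarith [hf0' l h]
          rw [this, ← hz]; simp
        · rw [div_self hp.ne', one_mul]
      · rw [mul_zero]
    have hΛP : Λ h = P h := by
      simp only [hΛ, hP, if_neg hha, if_neg hh0]; ring
    -- is `h` an absorber of `Λ` at `τ`? if `τ ≤ 2h` use `f`'s column bound; else no `f`-pair charges `h` (a pair needs `τ < l + h`, `2l < τ`)
    obtain ⟨hf0, hfsupp, _, hfcol⟩ := hf
    have hload : ∑ l ∈ Finset.range (j + 1), usage y τ j l h * f l h ≤ Λ h := by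
      by_cases hτh : τ ≤ 2 * (h : ℝ)
      · exact hfcol h hhM (Or.inr hτh)
      · -- every charged pair into `h` would need `τ < l + h` with `2l < τ`, i.e. `h > τ/2`: contradiction; so the column is empty
        have : ∑ l ∈ Finset.range (j + 1), usage y τ j l h * f l h = 0 := Finset.sum_eq_zero fun l _ => by
          rcases (hf0 l h).eq_or_lt with hz | hp
          · rw [← hz, mul_zero]
          · exfalso
            obtain ⟨_, hl2, _, hc⟩ := hfsupp l h hp
            rcases hc with hg | hc
            · omega
            · linarith
        rw [this]
        rw [hΛP]; exact hP0 h
    exact (hφcol h hhM).trans (hload.trans hΛP.le)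

end LawDec

end Quant

end Summit.CriticalPhenomena.PercolationContinuityZ3.Theorems
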